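import Mathlib
import Summits.ValiantsHypothesis.ValiantsHypothesis.Theorems.LacunarySymmetroidMatrixDescartesCensusWindowFourPocketRowsLog
import Summits.ValiantsHypothesis.ValiantsHypothesis.Theorems.LacunarySymmetroidMatrixDescartesCensusWindowFourSharpBridge

/-!
# `MatrixDescartes` census — WINDOW-4 POCKET ROWS, exponent-TABLE form (the shape a kernel kill file instantiates)

HONEST FRAMING.  Object-search cell `pub-symmetroid`, door-A target `DoorA26 := PosRootLawAt 2 6 19`
(stmt-ValiantsHypothesis-19979; OPEN, typed, never asserted).  Necessary-condition rows about the four-term WINDOWS of HYPOTHETICAL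
Descartes-sharp fewnomials; nothing here bounds any census count, kills any cell or bears on `MatrixDescartes`
(stmt-ValiantsHypothesis-18050) / `VP ≠ VNP`.

Packaging only.  The log-linear pocket rows of `…CensusWindowFourPocketRowsLog` (the four monotone transfers) and the secant rows of
`…CensusWindowFourPocketSecant`, composed with the bridge `window_four_three_le_countP_of_table` (`…CensusWindowFourSharpBridge`), in the
currency a generated kill file of the exact-tube instrument (engine-2 `hybrid38` / `exacttubet`, row kinds `xt-lo`, `xt-hi`, `xt-sec`) has
at a node: the exponent table `E` (a list literal), the window `r < s < u < v < n` with gaps `U₁, V, W` and the four absolute twist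
multipliers `M_t` read off `E`, a RATIONAL branch parameter `t = tn / td` given by two naturals, the branch side condition as a natural-number
inequality (`decide`/`norm_num`), the two naturals `An = (U₁+V)·td + W·tn`, `Bn = U₁·td + (V+W)·tn` (so that
`log((U₁+V) + W t) = log An − log td`, `log(U₁ + (V+W) t) = log Bn − log td`, `log t = log tn − log td` and every logarithm is the logarithm of
a natural number the kill file expands over its prime table), and the premise / conclusion in SPLIT logarithms
`Real.log |c t| + Real.log M_t`.  With `σ1 := (U₁+V)(log|c_s|+log M_s) − V(log|c_r|+log M_r) − U₁(log|c_u|+log M_u)`,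
`σ2 := (V+W)(log|c_u|+log M_u) − W(log|c_s|+log M_s) − V(log|c_v|+log M_v)`,
`Λ1 := (U₁+V) log An − U₁ log Bn − V log td − V log V` (`= log H1(t)`), `Λ2 := (V+W) log Bn − W log An − V log tn − V log V` (`= log H2(t)`):

* `window_four_pocket_lower_log_of_table`   (lower branch `W(V+W)tn ≤ U₁(U₁+V)td`): `Λ2 ≤ σ2 ⇒ Λ1 ≤ σ1`;
* `window_four_pocket_lower_log_of_table'`  (lower branch): `σ1 ≤ Λ1 ⇒ σ2 ≤ Λ2`;
* `window_four_pocket_upper_log_of_table`   (upper branch `U₁(U₁+V)td ≤ W(V+W)tn`): `Λ1 ≤ σ1 ⇒ Λ2 ≤ σ2`;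
* `window_four_pocket_upper_log_of_table'`  (upper branch): `σ2 ≤ Λ2 ⇒ σ1 ≤ Λ1`;
* `window_four_table_prelims`: the bridge data every table row extracts (gap positivity, the window 4-nomial's three roots, split logs);
  the secant rows in the same currency are in `…CensusWindowFourPocketTableSecant`.

[folklore] `Real.log` of products and quotients; elementary.  Tool of the `pub-symmetroid` exact-tube typing path (engine-2 g35).
-/

-- `Summit.ValiantsHypothesis.ValiantsHypothesis.…` repeats a component by the D-0017 layout
-- (single-conjunct summit), which the `dupNamespace` linter flags; the name is mandated.
set_option linter.dupNamespace false

namespace Summit.ValiantsHypothesis.ValiantsHypothesis.Theorems.LacunarySymmetroidMatrixDescartes.Census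

open Polynomial Finset Set
open scoped BigOperators Polynomial

/-- Logarithm of an affine form at a rational point: `p + q·(tn/td) = N/td` for the natural `N = p·td + q·tn`, so
`log(p + q·tn/td) = log N − log td`. [folklore] -/
theorem log_affine_ratio_of_nat (p q tn td N : ℕ) (htd : 0 < td) (hN : p * td + q * tn = N) (hN0 : 0 < N) :
    Real.log ((p : ℝ) + (q : ℝ) * ((tn : ℝ) / (td : ℝ))) = Real.log (N : ℝ) - Real.log (td : ℝ) := by
  have htd' : (0 : ℝ) < td := by exact_mod_cast htd
  have hN' : ((p : ℝ) * td + (q : ℝ) * tn) = (N : ℝ) := by exact_mod_cast hN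
  have h : (p : ℝ) + (q : ℝ) * ((tn : ℝ) / (td : ℝ)) = (N : ℝ) / (td : ℝ) := by
    rw [← hN']; field_simp
  rw [h, Real.log_div (by exact_mod_cast hN0.ne') htd'.ne']

/-- The data every table row below extracts from the bridge and the exponent table: positivity of the gaps and of the
normalised window coefficients, the split logarithms, and `≥ 3` positive roots of the window 4-nomial. -/
theorem window_four_table_prelims {n : ℕ} {e : ℕ → ℕ} {c : ℕ → ℝ} (he : ∀ i j, i < j → j < n → e i < e j)
    (hZ : n ≤ (∑ t ∈ range n, C (c t) * X ^ (e t) : ℝ[X]).roots.countP (fun x => 0 < x) + 1)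
    (E : List ℕ) (hE : ∀ t, t < n → e t = E.getD t 0)
    {r s u v : ℕ} (hrs : r < s) (hsu : s < u) (huv : u < v) (hvn : v < n) (U₁ V W : ℕ)
    (hU₁ : E.getD r 0 + U₁ = E.getD s 0) (hV : E.getD s 0 + V = E.getD u 0) (hW : E.getD u 0 + W = E.getD v 0)
    (Mr Ms Mu Mv : ℝ)
    (hMr : |∏ w ∈ (range n).filter (fun w => ¬(w = r ∨ w = s ∨ w = u ∨ w = v)), (((E.getD r 0 : ℕ) : ℝ) - (E.getD w 0 : ℕ))| = Mr)
    (hMs : |∏ w ∈ (range n).filter (fun w => ¬(w = r ∨ w = s ∨ w = u ∨ w = v)), (((E.getD s 0 : ℕ) : ℝ) - (E.getD w 0 : ℕ))| = Ms)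
    (hMu : |∏ w ∈ (range n).filter (fun w => ¬(w = r ∨ w = s ∨ w = u ∨ w = v)), (((E.getD u 0 : ℕ) : ℝ) - (E.getD w 0 : ℕ))| = Mu)
    (hMv : |∏ w ∈ (range n).filter (fun w => ¬(w = r ∨ w = s ∨ w = u ∨ w = v)), (((E.getD v 0 : ℕ) : ℝ) - (E.getD w 0 : ℕ))| = Mv) :
    0 < U₁ ∧ 0 < V ∧ 0 < W ∧
    (3 ≤ ((C (|c r| * Mr) - C (|c s| * Ms) * X ^ U₁ + C (|c u| * Mu) * X ^ (U₁ + V) - C (|c v| * Mv) * X ^ (U₁ + V + W)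
          : ℝ[X]).roots.countP (fun x => 0 < x))
      ∧ 0 < |c r| * Mr ∧ 0 < |c s| * Ms ∧ 0 < |c u| * Mu ∧ 0 < |c v| * Mv) ∧
    Real.log (|c r| * Mr) = Real.log |c r| + Real.log Mr ∧ Real.log (|c s| * Ms) = Real.log |c s| + Real.log Ms ∧
    Real.log (|c u| * Mu) = Real.log |c u| + Real.log Mu ∧ Real.log (|c v| * Mv) = Real.log |c v| + Real.log Mv := by
  have hbr := window_four_three_le_countP_of_table he hZ E hE hrs hsu huv hvn U₁ V W hU₁ hV hW Mr Ms Mu Mv hMr hMs hMu hMv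
  have hA := hbr.2.1
  have hB := hbr.2.2.1
  have hC := hbr.2.2.2.1
  have hD := hbr.2.2.2.2
  have ers := he r s hrs (by omega)
  have esu := he s u hsu (by omega)
  have euv := he u v huv hvn
  rw [hE r (by omega), hE s (by omega)] at ers
  rw [hE s (by omega), hE u (by omega)] at esu
  rw [hE u (by omega), hE v hvn] at euv
  refine ⟨by omega, by omega, by omega, hbr, ?_, ?_, ?_, ?_⟩
  · exact Real.log_mul (mul_ne_zero_iff.mp hA.ne').1 (mul_ne_zero_iff.mp hA.ne').2
  · exact Real.log_mul (mul_ne_zero_iff.mp hB.ne').1 (mul_ne_zero_iff.mp hB.ne').2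
  · exact Real.log_mul (mul_ne_zero_iff.mp hC.ne').1 (mul_ne_zero_iff.mp hC.ne').2
  · exact Real.log_mul (mul_ne_zero_iff.mp hD.ne').1 (mul_ne_zero_iff.mp hD.ne').2

/-- **Pocket row A, table form** (lower branch `W(V+W)·tn ≤ U₁(U₁+V)·td`, `t = tn/td`): `Λ2(t) ≤ σ2 ⇒ Λ1(t) ≤ σ1` in split logarithms
(see the module docstring for `Λ1, Λ2, σ1, σ2, An, Bn`). [folklore] -/
theorem window_four_pocket_lower_log_of_table {n : ℕ} {e : ℕ → ℕ} {c : ℕ → ℝ} (he : ∀ i j, i < j → j < n → e i < e j)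
    (hZ : n ≤ (∑ t ∈ range n, C (c t) * X ^ (e t) : ℝ[X]).roots.countP (fun x => 0 < x) + 1)
    (E : List ℕ) (hE : ∀ t, t < n → e t = E.getD t 0)
    {r s u v : ℕ} (hrs : r < s) (hsu : s < u) (huv : u < v) (hvn : v < n) (U₁ V W : ℕ)
    (hU₁ : E.getD r 0 + U₁ = E.getD s 0) (hV : E.getD s 0 + V = E.getD u 0) (hW : E.getD u 0 + W = E.getD v 0)
    (Mr Ms Mu Mv : ℝ)
    (hMr : |∏ w ∈ (range n).filter (fun w => ¬(w = r ∨ w = s ∨ w = u ∨ w = v)), (((E.getD r 0 : ℕ) : ℝ) - (E.getD w 0 : ℕ))| = Mr)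
    (hMs : |∏ w ∈ (range n).filter (fun w => ¬(w = r ∨ w = s ∨ w = u ∨ w = v)), (((E.getD s 0 : ℕ) : ℝ) - (E.getD w 0 : ℕ))| = Ms)
    (hMu : |∏ w ∈ (range n).filter (fun w => ¬(w = r ∨ w = s ∨ w = u ∨ w = v)), (((E.getD u 0 : ℕ) : ℝ) - (E.getD w 0 : ℕ))| = Mu)
    (hMv : |∏ w ∈ (range n).filter (fun w => ¬(w = r ∨ w = s ∨ w = u ∨ w = v)), (((E.getD v 0 : ℕ) : ℝ) - (E.getD w 0 : ℕ))| = Mv)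
    (tn td An Bn : ℕ) (htn : 0 < tn) (htd : 0 < td) (hAn : (U₁ + V) * td + W * tn = An) (hBn : U₁ * td + (V + W) * tn = Bn)
    (hlow : W * (V + W) * tn ≤ U₁ * (U₁ + V) * td)
    (hM : ((V : ℝ) + W) * Real.log (Bn : ℝ) - (W : ℝ) * Real.log (An : ℝ) - (V : ℝ) * Real.log (tn : ℝ) - (V : ℝ) * Real.log (V : ℝ)
      ≤ ((V : ℝ) + W) * (Real.log |c u| + Real.log Mu) - (W : ℝ) * (Real.log |c s| + Real.log Ms)
        - (V : ℝ) * (Real.log |c v| + Real.log Mv)) :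
    ((U₁ : ℝ) + V) * Real.log (An : ℝ) - (U₁ : ℝ) * Real.log (Bn : ℝ) - (V : ℝ) * Real.log (td : ℝ) - (V : ℝ) * Real.log (V : ℝ)
      ≤ ((U₁ : ℝ) + V) * (Real.log |c s| + Real.log Ms) - (V : ℝ) * (Real.log |c r| + Real.log Mr)
        - (U₁ : ℝ) * (Real.log |c u| + Real.log Mu) := by
  obtain ⟨hU, hVp, hWp, ⟨h3, hA, hB, hC, hD⟩, er, es, eu, ev⟩ :=
    window_four_table_prelims he hZ E hE hrs hsu huv hvn U₁ V W hU₁ hV hW Mr Ms Mu Mv hMr hMs hMu hMv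
  have hAn0 : 0 < An := by rw [← hAn]; positivity
  have hBn0 : 0 < Bn := by rw [← hBn]; positivity
  have htd' : (0 : ℝ) < td := by exact_mod_cast htd
  have ht : (0 : ℝ) < (tn : ℝ) / (td : ℝ) := by positivity
  have eA : Real.log (((U₁ : ℝ) + V) + (W : ℝ) * ((tn : ℝ) / (td : ℝ))) = Real.log (An : ℝ) - Real.log (td : ℝ) := by
    have h := log_affine_ratio_of_nat (U₁ + V) W tn td An htd hAn hAn0
    push_cast at h; exact h
  have eB : Real.log ((U₁ : ℝ) + ((V : ℝ) + W) * ((tn : ℝ) / (td : ℝ))) = Real.log (Bn : ℝ) - Real.log (td : ℝ) := by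
    have h := log_affine_ratio_of_nat U₁ (V + W) tn td Bn htd hBn hBn0
    push_cast at h; exact h
  have et : Real.log ((tn : ℝ) / (td : ℝ)) = Real.log (tn : ℝ) - Real.log (td : ℝ) :=
    Real.log_div (by exact_mod_cast htn.ne') htd'.ne'
  have hlow' : (W : ℝ) * ((V : ℝ) + W) * ((tn : ℝ) / (td : ℝ)) ≤ (U₁ : ℝ) * ((U₁ : ℝ) + V) := by
    have h : (W : ℝ) * ((V : ℝ) + W) * (tn : ℝ) ≤ (U₁ : ℝ) * ((U₁ : ℝ) + V) * (td : ℝ) := by exact_mod_cast hlow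
    rw [← mul_div_assoc, div_le_iff₀ htd']; exact h
  have hM' : (((V : ℝ) + W) * Real.log ((U₁ : ℝ) + ((V : ℝ) + W) * ((tn : ℝ) / (td : ℝ)))
        - (W : ℝ) * Real.log (((U₁ : ℝ) + V) + (W : ℝ) * ((tn : ℝ) / (td : ℝ))) - (V : ℝ) * Real.log ((tn : ℝ) / (td : ℝ)))
        - (V : ℝ) * Real.log (V : ℝ)
      ≤ (((V : ℝ) + W) * Real.log (|c u| * Mu) - (W : ℝ) * Real.log (|c s| * Ms) - (V : ℝ) * Real.log (|c v| * Mv)) := by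
    rw [eA, eB, et, eu, es, ev]; linarith
  have key := fourNomial_pocket_lower_log hU hVp hWp hA hB hC hD h3 ht hlow' hM'
  rw [eA, eB, er, es, eu] at key
  linarith

/-- **Pocket row B, table form** (lower branch): `σ1 ≤ Λ1(t) ⇒ σ2 ≤ Λ2(t)` in split logarithms. [folklore] -/
theorem window_four_pocket_lower_log_of_table' {n : ℕ} {e : ℕ → ℕ} {c : ℕ → ℝ} (he : ∀ i j, i < j → j < n → e i < e j)
    (hZ : n ≤ (∑ t ∈ range n, C (c t) * X ^ (e t) : ℝ[X]).roots.countP (fun x => 0 < x) + 1)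
    (E : List ℕ) (hE : ∀ t, t < n → e t = E.getD t 0)
    {r s u v : ℕ} (hrs : r < s) (hsu : s < u) (huv : u < v) (hvn : v < n) (U₁ V W : ℕ)
    (hU₁ : E.getD r 0 + U₁ = E.getD s 0) (hV : E.getD s 0 + V = E.getD u 0) (hW : E.getD u 0 + W = E.getD v 0)
    (Mr Ms Mu Mv : ℝ)
    (hMr : |∏ w ∈ (range n).filter (fun w => ¬(w = r ∨ w = s ∨ w = u ∨ w = v)), (((E.getD r 0 : ℕ) : ℝ) - (E.getD w 0 : ℕ))| = Mr)
    (hMs : |∏ w ∈ (range n).filter (fun w => ¬(w = r ∨ w = s ∨ w = u ∨ w = v)), (((E.getD s 0 : ℕ) : ℝ) - (E.getD w 0 : ℕ))| = Ms)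
    (hMu : |∏ w ∈ (range n).filter (fun w => ¬(w = r ∨ w = s ∨ w = u ∨ w = v)), (((E.getD u 0 : ℕ) : ℝ) - (E.getD w 0 : ℕ))| = Mu)
    (hMv : |∏ w ∈ (range n).filter (fun w => ¬(w = r ∨ w = s ∨ w = u ∨ w = v)), (((E.getD v 0 : ℕ) : ℝ) - (E.getD w 0 : ℕ))| = Mv)
    (tn td An Bn : ℕ) (htn : 0 < tn) (htd : 0 < td) (hAn : (U₁ + V) * td + W * tn = An) (hBn : U₁ * td + (V + W) * tn = Bn)
    (hlow : W * (V + W) * tn ≤ U₁ * (U₁ + V) * td)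
    (hH : ((U₁ : ℝ) + V) * (Real.log |c s| + Real.log Ms) - (V : ℝ) * (Real.log |c r| + Real.log Mr)
        - (U₁ : ℝ) * (Real.log |c u| + Real.log Mu)
      ≤ ((U₁ : ℝ) + V) * Real.log (An : ℝ) - (U₁ : ℝ) * Real.log (Bn : ℝ) - (V : ℝ) * Real.log (td : ℝ) - (V : ℝ) * Real.log (V : ℝ)) :
    ((V : ℝ) + W) * (Real.log |c u| + Real.log Mu) - (W : ℝ) * (Real.log |c s| + Real.log Ms) - (V : ℝ) * (Real.log |c v| + Real.log Mv)
      ≤ ((V : ℝ) + W) * Real.log (Bn : ℝ) - (W : ℝ) * Real.log (An : ℝ) - (V : ℝ) * Real.log (tn : ℝ) - (V : ℝ) * Real.log (V : ℝ) := by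
  obtain ⟨hU, hVp, hWp, ⟨h3, hA, hB, hC, hD⟩, er, es, eu, ev⟩ :=
    window_four_table_prelims he hZ E hE hrs hsu huv hvn U₁ V W hU₁ hV hW Mr Ms Mu Mv hMr hMs hMu hMv
  have hAn0 : 0 < An := by rw [← hAn]; positivity
  have hBn0 : 0 < Bn := by rw [← hBn]; positivity
  have htd' : (0 : ℝ) < td := by exact_mod_cast htd
  have ht : (0 : ℝ) < (tn : ℝ) / (td : ℝ) := by positivity
  have eA : Real.log (((U₁ : ℝ) + V) + (W : ℝ) * ((tn : ℝ) / (td : ℝ))) = Real.log (An : ℝ) - Real.log (td : ℝ) := by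
    have h := log_affine_ratio_of_nat (U₁ + V) W tn td An htd hAn hAn0
    push_cast at h; exact h
  have eB : Real.log ((U₁ : ℝ) + ((V : ℝ) + W) * ((tn : ℝ) / (td : ℝ))) = Real.log (Bn : ℝ) - Real.log (td : ℝ) := by
    have h := log_affine_ratio_of_nat U₁ (V + W) tn td Bn htd hBn hBn0
    push_cast at h; exact h
  have et : Real.log ((tn : ℝ) / (td : ℝ)) = Real.log (tn : ℝ) - Real.log (td : ℝ) :=
    Real.log_div (by exact_mod_cast htn.ne') htd'.ne'
  have hlow' : (W : ℝ) * ((V : ℝ) + W) * ((tn : ℝ) / (td : ℝ)) ≤ (U₁ : ℝ) * ((U₁ : ℝ) + V) := by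
    have h : (W : ℝ) * ((V : ℝ) + W) * (tn : ℝ) ≤ (U₁ : ℝ) * ((U₁ : ℝ) + V) * (td : ℝ) := by exact_mod_cast hlow
    rw [← mul_div_assoc, div_le_iff₀ htd']; exact h
  have hH' : (((U₁ : ℝ) + V) * Real.log (|c s| * Ms) - (V : ℝ) * Real.log (|c r| * Mr) - (U₁ : ℝ) * Real.log (|c u| * Mu))
      ≤ (((U₁ : ℝ) + V) * Real.log (((U₁ : ℝ) + V) + (W : ℝ) * ((tn : ℝ) / (td : ℝ)))
          - (U₁ : ℝ) * Real.log ((U₁ : ℝ) + ((V : ℝ) + W) * ((tn : ℝ) / (td : ℝ)))) - (V : ℝ) * Real.log (V : ℝ) := by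
    rw [eA, eB, er, es, eu]; linarith
  have key := fourNomial_pocket_lower_log' hU hVp hWp hA hB hC hD h3 ht hlow' hH'
  rw [eA, eB, et, es, eu, ev] at key
  linarith

/-- **Pocket row A′, table form** (upper branch `U₁(U₁+V)·td ≤ W(V+W)·tn`): `Λ1(t) ≤ σ1 ⇒ Λ2(t) ≤ σ2` in split logarithms. [folklore] -/
theorem window_four_pocket_upper_log_of_table {n : ℕ} {e : ℕ → ℕ} {c : ℕ → ℝ} (he : ∀ i j, i < j → j < n → e i < e j)
    (hZ : n ≤ (∑ t ∈ range n, C (c t) * X ^ (e t) : ℝ[X]).roots.countP (fun x => 0 < x) + 1)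
    (E : List ℕ) (hE : ∀ t, t < n → e t = E.getD t 0)
    {r s u v : ℕ} (hrs : r < s) (hsu : s < u) (huv : u < v) (hvn : v < n) (U₁ V W : ℕ)
    (hU₁ : E.getD r 0 + U₁ = E.getD s 0) (hV : E.getD s 0 + V = E.getD u 0) (hW : E.getD u 0 + W = E.getD v 0)
    (Mr Ms Mu Mv : ℝ)
    (hMr : |∏ w ∈ (range n).filter (fun w => ¬(w = r ∨ w = s ∨ w = u ∨ w = v)), (((E.getD r 0 : ℕ) : ℝ) - (E.getD w 0 : ℕ))| = Mr)
    (hMs : |∏ w ∈ (range n).filter (fun w => ¬(w = r ∨ w = s ∨ w = u ∨ w = v)), (((E.getD s 0 : ℕ) : ℝ) - (E.getD w 0 : ℕ))| = Ms)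
    (hMu : |∏ w ∈ (range n).filter (fun w => ¬(w = r ∨ w = s ∨ w = u ∨ w = v)), (((E.getD u 0 : ℕ) : ℝ) - (E.getD w 0 : ℕ))| = Mu)
    (hMv : |∏ w ∈ (range n).filter (fun w => ¬(w = r ∨ w = s ∨ w = u ∨ w = v)), (((E.getD v 0 : ℕ) : ℝ) - (E.getD w 0 : ℕ))| = Mv)
    (tn td An Bn : ℕ) (htn : 0 < tn) (htd : 0 < td) (hAn : (U₁ + V) * td + W * tn = An) (hBn : U₁ * td + (V + W) * tn = Bn)
    (hup : U₁ * (U₁ + V) * td ≤ W * (V + W) * tn)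
    (hM : ((U₁ : ℝ) + V) * Real.log (An : ℝ) - (U₁ : ℝ) * Real.log (Bn : ℝ) - (V : ℝ) * Real.log (td : ℝ) - (V : ℝ) * Real.log (V : ℝ)
      ≤ ((U₁ : ℝ) + V) * (Real.log |c s| + Real.log Ms) - (V : ℝ) * (Real.log |c r| + Real.log Mr)
        - (U₁ : ℝ) * (Real.log |c u| + Real.log Mu)) :
    ((V : ℝ) + W) * Real.log (Bn : ℝ) - (W : ℝ) * Real.log (An : ℝ) - (V : ℝ) * Real.log (tn : ℝ) - (V : ℝ) * Real.log (V : ℝ)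
      ≤ ((V : ℝ) + W) * (Real.log |c u| + Real.log Mu) - (W : ℝ) * (Real.log |c s| + Real.log Ms)
        - (V : ℝ) * (Real.log |c v| + Real.log Mv) := by
  obtain ⟨hU, hVp, hWp, ⟨h3, hA, hB, hC, hD⟩, er, es, eu, ev⟩ :=
    window_four_table_prelims he hZ E hE hrs hsu huv hvn U₁ V W hU₁ hV hW Mr Ms Mu Mv hMr hMs hMu hMv
  have hAn0 : 0 < An := by rw [← hAn]; positivity
  have hBn0 : 0 < Bn := by rw [← hBn]; positivity
  have htd' : (0 : ℝ) < td := by exact_mod_cast htd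
  have eA : Real.log (((U₁ : ℝ) + V) + (W : ℝ) * ((tn : ℝ) / (td : ℝ))) = Real.log (An : ℝ) - Real.log (td : ℝ) := by
    have h := log_affine_ratio_of_nat (U₁ + V) W tn td An htd hAn hAn0
    push_cast at h; exact h
  have eB : Real.log ((U₁ : ℝ) + ((V : ℝ) + W) * ((tn : ℝ) / (td : ℝ))) = Real.log (Bn : ℝ) - Real.log (td : ℝ) := by
    have h := log_affine_ratio_of_nat U₁ (V + W) tn td Bn htd hBn hBn0
    push_cast at h; exact h
  have et : Real.log ((tn : ℝ) / (td : ℝ)) = Real.log (tn : ℝ) - Real.log (td : ℝ) :=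
    Real.log_div (by exact_mod_cast htn.ne') htd'.ne'
  have hup' : (U₁ : ℝ) * ((U₁ : ℝ) + V) ≤ (W : ℝ) * ((V : ℝ) + W) * ((tn : ℝ) / (td : ℝ)) := by
    have h : (U₁ : ℝ) * ((U₁ : ℝ) + V) * (td : ℝ) ≤ (W : ℝ) * ((V : ℝ) + W) * (tn : ℝ) := by exact_mod_cast hup
    rw [← mul_div_assoc, le_div_iff₀ htd']; exact h
  have hM' : (((U₁ : ℝ) + V) * Real.log (((U₁ : ℝ) + V) + (W : ℝ) * ((tn : ℝ) / (td : ℝ)))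
        - (U₁ : ℝ) * Real.log ((U₁ : ℝ) + ((V : ℝ) + W) * ((tn : ℝ) / (td : ℝ)))) - (V : ℝ) * Real.log (V : ℝ)
      ≤ (((U₁ : ℝ) + V) * Real.log (|c s| * Ms) - (V : ℝ) * Real.log (|c r| * Mr) - (U₁ : ℝ) * Real.log (|c u| * Mu)) := by
    rw [eA, eB, er, es, eu]; linarith
  have key := fourNomial_pocket_upper_log hU hVp hWp hA hB hC hD h3 hup' hM'
  rw [eA, eB, et, es, eu, ev] at key
  linarith

/-- **Pocket row B′, table form** (upper branch): `σ2 ≤ Λ2(t) ⇒ σ1 ≤ Λ1(t)` in split logarithms. [folklore] -/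
theorem window_four_pocket_upper_log_of_table' {n : ℕ} {e : ℕ → ℕ} {c : ℕ → ℝ} (he : ∀ i j, i < j → j < n → e i < e j)
    (hZ : n ≤ (∑ t ∈ range n, C (c t) * X ^ (e t) : ℝ[X]).roots.countP (fun x => 0 < x) + 1)
    (E : List ℕ) (hE : ∀ t, t < n → e t = E.getD t 0)
    {r s u v : ℕ} (hrs : r < s) (hsu : s < u) (huv : u < v) (hvn : v < n) (U₁ V W : ℕ)
    (hU₁ : E.getD r 0 + U₁ = E.getD s 0) (hV : E.getD s 0 + V = E.getD u 0) (hW : E.getD u 0 + W = E.getD v 0)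
    (Mr Ms Mu Mv : ℝ)
    (hMr : |∏ w ∈ (range n).filter (fun w => ¬(w = r ∨ w = s ∨ w = u ∨ w = v)), (((E.getD r 0 : ℕ) : ℝ) - (E.getD w 0 : ℕ))| = Mr)
    (hMs : |∏ w ∈ (range n).filter (fun w => ¬(w = r ∨ w = s ∨ w = u ∨ w = v)), (((E.getD s 0 : ℕ) : ℝ) - (E.getD w 0 : ℕ))| = Ms)
    (hMu : |∏ w ∈ (range n).filter (fun w => ¬(w = r ∨ w = s ∨ w = u ∨ w = v)), (((E.getD u 0 : ℕ) : ℝ) - (E.getD w 0 : ℕ))| = Mu)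
    (hMv : |∏ w ∈ (range n).filter (fun w => ¬(w = r ∨ w = s ∨ w = u ∨ w = v)), (((E.getD v 0 : ℕ) : ℝ) - (E.getD w 0 : ℕ))| = Mv)
    (tn td An Bn : ℕ) (htn : 0 < tn) (htd : 0 < td) (hAn : (U₁ + V) * td + W * tn = An) (hBn : U₁ * td + (V + W) * tn = Bn)
    (hup : U₁ * (U₁ + V) * td ≤ W * (V + W) * tn)
    (hH : ((V : ℝ) + W) * (Real.log |c u| + Real.log Mu) - (W : ℝ) * (Real.log |c s| + Real.log Ms)
        - (V : ℝ) * (Real.log |c v| + Real.log Mv)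
      ≤ ((V : ℝ) + W) * Real.log (Bn : ℝ) - (W : ℝ) * Real.log (An : ℝ) - (V : ℝ) * Real.log (tn : ℝ) - (V : ℝ) * Real.log (V : ℝ)) :
    ((U₁ : ℝ) + V) * (Real.log |c s| + Real.log Ms) - (V : ℝ) * (Real.log |c r| + Real.log Mr) - (U₁ : ℝ) * (Real.log |c u| + Real.log Mu)
      ≤ ((U₁ : ℝ) + V) * Real.log (An : ℝ) - (U₁ : ℝ) * Real.log (Bn : ℝ) - (V : ℝ) * Real.log (td : ℝ) - (V : ℝ) * Real.log (V : ℝ) := by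
  obtain ⟨hU, hVp, hWp, ⟨h3, hA, hB, hC, hD⟩, er, es, eu, ev⟩ :=
    window_four_table_prelims he hZ E hE hrs hsu huv hvn U₁ V W hU₁ hV hW Mr Ms Mu Mv hMr hMs hMu hMv
  have hAn0 : 0 < An := by rw [← hAn]; positivity
  have hBn0 : 0 < Bn := by rw [← hBn]; positivity
  have htd' : (0 : ℝ) < td := by exact_mod_cast htd
  have eA : Real.log (((U₁ : ℝ) + V) + (W : ℝ) * ((tn : ℝ) / (td : ℝ))) = Real.log (An : ℝ) - Real.log (td : ℝ) := by
    have h := log_affine_ratio_of_nat (U₁ + V) W tn td An htd hAn hAn0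
    push_cast at h; exact h
  have eB : Real.log ((U₁ : ℝ) + ((V : ℝ) + W) * ((tn : ℝ) / (td : ℝ))) = Real.log (Bn : ℝ) - Real.log (td : ℝ) := by
    have h := log_affine_ratio_of_nat U₁ (V + W) tn td Bn htd hBn hBn0
    push_cast at h; exact h
  have et : Real.log ((tn : ℝ) / (td : ℝ)) = Real.log (tn : ℝ) - Real.log (td : ℝ) :=
    Real.log_div (by exact_mod_cast htn.ne') htd'.ne'
  have hup' : (U₁ : ℝ) * ((U₁ : ℝ) + V) ≤ (W : ℝ) * ((V : ℝ) + W) * ((tn : ℝ) / (td : ℝ)) := by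
    have h : (U₁ : ℝ) * ((U₁ : ℝ) + V) * (td : ℝ) ≤ (W : ℝ) * ((V : ℝ) + W) * (tn : ℝ) := by exact_mod_cast hup
    rw [← mul_div_assoc, le_div_iff₀ htd']; exact h
  have hH' : (((V : ℝ) + W) * Real.log (|c u| * Mu) - (W : ℝ) * Real.log (|c s| * Ms) - (V : ℝ) * Real.log (|c v| * Mv))
      ≤ (((V : ℝ) + W) * Real.log ((U₁ : ℝ) + ((V : ℝ) + W) * ((tn : ℝ) / (td : ℝ)))
          - (W : ℝ) * Real.log (((U₁ : ℝ) + V) + (W : ℝ) * ((tn : ℝ) / (td : ℝ))) - (V : ℝ) * Real.log ((tn : ℝ) / (td : ℝ)))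
          - (V : ℝ) * Real.log (V : ℝ) := by
    rw [eA, eB, et, es, eu, ev]; linarith
  have key := fourNomial_pocket_upper_log' hU hVp hWp hA hB hC hD h3 hup' hH'
  rw [eA, eB, er, es, eu] at key
  linarith

end Summit.ValiantsHypothesis.ValiantsHypothesis.Theorems.LacunarySymmetroidMatrixDescartes.Census
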